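import Mathlib
import Summits.ResolutionOfSingularities.ResolutionOfSingularities.Theorems.AbhyankarShadowsSemivaluationShadowsHenselOverRuledShadowsRankOneHelpers3
import Summits.ResolutionOfSingularities.ResolutionOfSingularities.Theorems.AbhyankarShadowsSemivaluationShadowsHenselOverRuledShadowsRankOneHelpers4
import Summits.ResolutionOfSingularities.ResolutionOfSingularities.Theorems.ShadowsUniformize.Negative.IdentityShadow
import HarnessLib

/-!
# Shadows for Hensel-generated top layers over a ruled skeleton, rational rank one: assembly

Crux `SemivaluationShadows` (item `stmt-ResolutionOfSingularities-16757`, route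
`ResolutionOfSingularities/AbhyankarShadows`), line `birth`, registered stub
`stub_henselOverRuledShadowsRankOne`: this file proves the general form
`henselOverRuledShadowsRankOne_of` (the saturation taken in any algebraically closed algebraic
extension `M ⊇ K`); the registered signature is derived from it in the stub file
`…HenselOverRuledShadowsRankOne.lean` (with `M = K̄`).

**Proof** (`K₁ = K₀(v)`, `K = K₁(η)`, `η` a Hensel root of `h` over `O ∩ K₁`).
1. UPSTAIRS (`exists_minpoly_cofactor`, `exists_rep`, `exists_approximant`): `h = m g` with
   `m` minimal, `g(η) ≠ 0`; every `z ∈ K` is `q_z(η)`; ONE Newton approximant `a ∈ K₁ ∩ O` of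
   `η` serves the finitely many prescribed `q_z` (generators minus constants, elements of `F`)
   and `g`: `ν(h'(a)) = 1`, gap `ν(b h(a)) < ν(q(a)) = ν(q(η))`.
2. `exists_saturation_approximant`: `V ⊇ O` on `M`, and `ρ'` ALGEBRAIC over `K₀`, exact on the
   numerators/denominators of the finite set `T ⊆ K₁` of fixed elements and below its degree;
   `exists_exact_evalMap`: `φ' : D = K₀[v, T] → M`, `v ↦ ρ'`, exact on `T`, valued in `K₀(ρ')`.
3. `exists_root_package`: the root `ζ` of `h^φ'` near `φ'(a)` is a Hensel root over
   `V ∩ K₀(ρ')` and a root of `m^φ'`; `exists_ringHom_of_root`: `Φ : D[η] → M`, `η ↦ ζ`;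
   `transport`: `V(Φ z) = ν(q_z(a))`, `ν(q_z(a)) = ν(z)` for the prescribed `z`.
4. `exists_frame_poly`: a uniformising polynomial `g_π` of `K₀(ρ')`, exact by minimality
   (`ẽ = g_π(v)`), whose value generates the values of `L = K₀(ρ', ζ)`;
   `shadow_of_transport`: the datum `(k[s, t, η, ẽ], L, Φ|, V ∩ L)` is a shadow exact on `F`.

No named fact is used. [folklore]
-/

set_option linter.dupNamespace false

noncomputable section

open Polynomial Literature.AlgebraicGeometry.Resolution

namespace Summit.ResolutionOfSingularities.ResolutionOfSingularities.Theorems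

set_option maxHeartbeats 400000 in
/-- **Shadows for a Hensel-generated top layer over a ruled skeleton, rational rank one**
(general form: the saturation is taken in any algebraically closed algebraic extension `M` of
`K`; module docstring). [folklore] -/
theorem henselOverRuledShadowsRankOne_of (k K : Type) [Field k] [IsAlgClosed k] [Field K]
    [Algebra k K] (hfg : (⊤ : IntermediateField k K).FG) (O : ValuationSubring K)
    (hk : ∀ c : k, algebraMap k K c ∈ O)
    (hrat : ∀ x : K, x ∈ O → ∃ c : k, O.valuation (x - algebraMap k K c) < 1)
    (hrr : Module.finrank ℤ (Additive (O.ValueGroup)ˣ) = 1) (K₀ : IntermediateField k K)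
    (t v η : K) (h : K[X]) (htK₀ : t ∈ K₀) (ht0 : t ≠ 0) (ht1 : O.valuation t < 1)
    (hdisc : ∀ x : K, x ∈ K₀ → x ≠ 0 → ∃ m : ℤ, O.valuation x = O.valuation t ^ m)
    (hv : Transcendental K₀ v)
    (hcoef : ∀ i : ℕ, h.coeff i ∈ IntermediateField.adjoin K₀ {v} ∧ h.coeff i ∈ O)
    (hmon : h.Monic) (hroot : aeval η h = 0)
    (hder : O.valuation (aeval η (derivative h)) = 1) (hηO : η ∈ O)
    (hgen : IntermediateField.adjoin K₀ {v, η} = ⊤)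
    (R : Subalgebra k K) (hR : R.FG) (hRO : R.toSubring ≤ O.toSubring) (F : Finset R)
    (M : Type) [Field M] [IsAlgClosed M] [Algebra K M] [Algebra k M] [IsScalarTower k K M]
    [Algebra.IsAlgebraic K M] :
    ∃ (R₁ : Subalgebra k K) (hle : R ≤ R₁) (_ : R₁.toSubring ≤ O.toSubring), R₁.FG ∧
    IsFractionRing R₁ K ∧ ∃ (L : Type) (_ : Field L) (_ : Algebra k L) (φ : R₁ →ₐ[k] L)
    (O' : ValuationSubring L), Module.finrank ℤ (Additive (O'.ValueGroup)ˣ) =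
      Module.finrank ℤ (Additive (O.ValueGroup)ˣ) ∧ (∀ y : R₁, φ y ∈ O') ∧
    (∀ y : R₁, O'.valuation (φ y) < 1 ↔ O.valuation (y : K) < 1) ∧
    (∀ z : L, z ∈ O' → ∃ c : k, O'.valuation (z - algebraMap k L c) < 1) ∧
    (MonoidHom.mrange (O'.valuation.toMonoidWithZeroHom.toMonoidHom.comp
      φ.toRingHom.toMonoidHom)).FG ∧
    ∃ ι : O'.ValueGroup →*₀o O.ValueGroup, Function.Injective ι ∧
      (∀ y : R₁, φ y ≠ 0 → ∃ y' : R₁, ι (O'.valuation (φ y)) = O.valuation (y' : K)) ∧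
      ∀ x ∈ F, ι (O'.valuation (φ (Subalgebra.inclusion hle x))) = O.valuation ((x : R) : K) := by
  classical
  /- 0. constants, `K₁ = K₀(v)` -/
  set ι : K →+* M := algebraMap K M with hιdef
  set K₁ : IntermediateField K₀ K := IntermediateField.adjoin K₀ {v} with hK₁def
  have hkK₀ : ∀ c : k, algebraMap k K c ∈ K₀ := fun c => K₀.algebraMap_mem c
  have hK₀K₁ : ∀ x : K, x ∈ K₀ → x ∈ K₁ := fun x hx => K₁.algebraMap_mem (⟨x, hx⟩ : K₀)
  have hvK₁ : v ∈ K₁ := IntermediateField.mem_adjoin_simple_self K₀ v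
  have hroot' : h.eval η = 0 := by rw [← coe_aeval_eq_eval]; exact hroot
  have hder' : O.valuation ((derivative h).eval η) = 1 := by rw [← coe_aeval_eq_eval]; exact hder
  have hcoefO : ∀ i, h.coeff i ∈ O := fun i => (hcoef i).2
  have hcoefK₁ : ∀ i, h.coeff i ∈ K₁ := fun i => (hcoef i).1
  have hevalK₁ : ∀ r : K[X], (∀ i, r.coeff i ∈ K₁) → ∀ x ∈ K₁, r.eval x ∈ K₁ :=
    fun r hr x hx => eval_mem_subfield_of_coeff_mem (L := K₁.toSubfield) hr hx
  /- 1. upstairs algebra: `h = m g`, representations, residue constants, coefficient bounds -/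
  obtain ⟨m, g, hmmon, hmK₁, hgK₁, hhmg, hmη, hgη, hint, hmin⟩ :=
    HenselShadows.exists_minpoly_cofactor K₁ hcoefK₁ hmon hroot' (fun h0 => by
      rw [h0, map_zero] at hder'; exact zero_ne_one hder')
  have hrep := HenselShadows.exists_rep (F := K₀) v η hgen hint
  choose rep hrepK₁ hrepη using hrep
  obtain ⟨c₀, hc₀⟩ := hrat η hηO
  set c₀K : K := algebraMap k K c₀ with hc₀Kdef
  have hc' : ∀ x : K, ∃ c : k, x ∈ O → O.valuation (x - algebraMap k K c) < 1 := fun x => by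
    by_cases hx : x ∈ O
    · obtain ⟨c, hc⟩ := hrat x hx
      exact ⟨c, fun _ => hc⟩
    · exact ⟨0, fun h' => absurd h' hx⟩
  choose cst hcst using hc'
  have hbex : ∀ q : K[X], ∃ b : K, ∀ i, O.valuation (q.coeff i) ≤ O.valuation b := by
    intro q
    by_cases hq : q = 0
    · exact ⟨0, fun i => by rw [hq, coeff_zero]⟩
    · obtain ⟨i₀, -, hi₀⟩ := Finset.exists_max_image q.support (fun i => O.valuation (q.coeff i))
        (Polynomial.support_nonempty.mpr hq)
      refine ⟨q.coeff i₀, fun i => ?_⟩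
      by_cases hi : i ∈ q.support
      · exact hi₀ i hi
      · rw [Polynomial.notMem_support_iff.mp hi, map_zero]; exact zero_le
  choose bnd hbnd using hbex
  /- 2. a first model; the prescribed elements; the Newton approximant `a` -/
  obtain ⟨R₀, hRR₀, hR₀O, ⟨s, hs⟩, hfrac₀⟩ :=
    ShadowsUniformize.Negative.exists_fg_isFractionRing_le hfg O hk R hR hRO
  have hsO : ∀ x ∈ s, x ∈ O := fun x hx => hR₀O (hs ▸ Algebra.subset_adjoin hx)
  set Z : Finset K := (s.image fun x => x - algebraMap k K (cst x)) ∪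
    F.image fun x => ((x : R) : K) with hZdef
  set Tpoly : Finset K[X] := insert h (insert m (insert g ((Z ∪ s).image rep))) with hTpolydef
  have hTpolyK₁ : ∀ r ∈ Tpoly, ∀ i, r.coeff i ∈ K₁ := by
    intro r hr i
    simp only [hTpolydef, Finset.mem_insert, Finset.mem_image] at hr
    rcases hr with rfl | rfl | rfl | ⟨z, -, rfl⟩
    exacts [hcoefK₁ i, hmK₁ i, hgK₁ i, hrepK₁ z i]
  set QB : Finset (K[X] × K) := Tpoly.image fun r => (r, bnd r) with hQBdef
  have hνt0 : O.valuation t ≠ 0 := (Valuation.ne_zero_iff _).mpr ht0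
  have harchO : ∀ B γ δ : ValuationSubring.ValueGroup O, γ < 1 → δ ≠ 0 →
      ∃ n : ℕ, B * γ ^ (n + 1) < δ :=
    HenselShadows.exists_mul_pow_lt hνt0 ht1 fun γ hγ =>
      exists_pow_eq_zpow_of_finrank_eq_one hrr hγ hνt0 ht1.ne
  obtain ⟨a, haK₁, haO, hac₀, hda, hηa, hQB⟩ := HenselShadows.exists_approximant O K₁.toSubfield
    harchO hcoefO (fun n => hcoefK₁ n) hηO hroot' hder' (hK₀K₁ _ (hkK₀ c₀)) (hk c₀) hc₀ QB
    (fun pr hpr n => by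
      obtain ⟨r, -, rfl⟩ := Finset.mem_image.mp hpr
      exact hbnd r n)
  replace haK₁ : a ∈ K₁ := haK₁
  have hgap : ∀ r ∈ Tpoly, r.eval η ≠ 0 → O.valuation (bnd r * h.eval a) < O.valuation (r.eval a)
      ∧ O.valuation (r.eval a) = O.valuation (r.eval η) := fun r hr hr0 =>
    hQB (r, bnd r) (Finset.mem_image.mpr ⟨r, hr, rfl⟩) hr0
  have hrepT : ∀ z ∈ Z ∪ s, rep z ∈ Tpoly := fun z hz => by
    simp only [hTpolydef, Finset.mem_insert, Finset.mem_image]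
    exact Or.inr (Or.inr (Or.inr ⟨z, hz, rfl⟩))
  have hhT : h ∈ Tpoly := by simp [hTpolydef]
  have hmT : m ∈ Tpoly := by simp [hTpolydef]
  have hgT : g ∈ Tpoly := by simp [hTpolydef]
  have hha1 : O.valuation (h.eval a) < 1 := by
    rw [show h.eval a = h.eval a - h.eval η by rw [hroot', sub_zero]]
    exact lt_of_le_of_lt (valuation_eval_sub_eval_le O hcoefO haO hηO)
      (by rwa [Valuation.map_sub_swap])
  /- 3. the finite exactness set `T ⊆ K₁` and its fractions over `K₀` -/
  set T : Finset K := (Tpoly.biUnion fun r => r.coeffs ∪ {r.eval a}) ∪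
    {a, a - c₀K, (derivative h).eval a} with hTdef
  have hTc : ∀ r ∈ Tpoly, ∀ n, r.coeff n ≠ 0 → r.coeff n ∈ T := fun r hr n hn =>
    Finset.mem_union_left _ (Finset.mem_biUnion.mpr
      ⟨r, hr, Finset.mem_union_left _ (coeff_mem_coeffs hn)⟩)
  have hTe : ∀ r ∈ Tpoly, r.eval a ∈ T := fun r hr =>
    Finset.mem_union_left _ (Finset.mem_biUnion.mpr ⟨r, hr, Finset.mem_union_right _ (by simp)⟩)
  have hT_a : a ∈ T := Finset.mem_union_right _ (by simp)
  have hT_ac₀ : a - c₀K ∈ T := Finset.mem_union_right _ (by simp)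
  have hT_da : (derivative h).eval a ∈ T := Finset.mem_union_right _ (by simp)
  have hTK₁ : ∀ x ∈ T, x ∈ K₁ := by
    intro x hx
    simp only [hTdef, Finset.mem_union, Finset.mem_biUnion, Finset.mem_insert,
      Finset.mem_singleton, mem_coeffs_iff] at hx
    rcases hx with ⟨r, hr, ⟨n, -, rfl⟩ | rfl⟩ | (rfl | rfl | rfl)
    · exact hTpolyK₁ r hr n
    · exact hevalK₁ r (hTpolyK₁ r hr) a haK₁
    · exact haK₁
    · exact sub_mem haK₁ (hK₀K₁ _ (hkK₀ c₀))
    · exact hevalK₁ _ (coeff_derivative_mem_subfield (L := K₁.toSubfield) hcoefK₁) a haK₁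
  have hinjv : Function.Injective (aeval v : K₀[X] →ₐ[K₀] K) := transcendental_iff_injective.mp hv
  have haev0 : ∀ f : K₀[X], f ≠ 0 → aeval v f ≠ 0 := fun f hf => (map_ne_zero_iff _ hinjv).mpr hf
  have hfr : ∀ x : K, ∃ P Q : K₀[X], Q ≠ 0 ∧ (x ∈ K₁ → x * aeval v Q = aeval v P) := by
    intro x
    by_cases hx : x ∈ K₁
    · obtain ⟨r, s', hrs⟩ := (IntermediateField.mem_adjoin_simple_iff K₀ x).mp hx
      by_cases hs' : aeval v s' = 0
      · refine ⟨0, 1, one_ne_zero, fun _ => ?_⟩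
        rw [hrs, hs', div_zero, zero_mul, map_zero]
      · refine ⟨r, s', fun h0 => hs' (by rw [h0, map_zero]), fun _ => ?_⟩
        rw [hrs, div_mul_cancel₀ _ hs']
    · exact ⟨0, 1, one_ne_zero, fun h' => absurd h' hx⟩
  choose P Q hQ0 hPQ using hfr
  set S₀ : Finset K₀[X] := T.biUnion fun x => {P x, Q x} with hS₀def
  have hPmem : ∀ x ∈ T, P x ∈ S₀ := fun x hx => Finset.mem_biUnion.mpr ⟨x, hx, by simp⟩
  have hQmem : ∀ x ∈ T, Q x ∈ S₀ := fun x hx => Finset.mem_biUnion.mpr ⟨x, hx, by simp⟩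
  /- 4. saturation `V`, minimal approximant `ρ'`, evaluation map `φ'` exact on `T` -/
  obtain ⟨V, ρ', hVO, hres, harchV, hρ'int, hex, hexlow⟩ :=
    HenselShadows.exists_saturation_approximant k K M O hk hrat hrr K₀ t v htK₀ ht0 ht1 hv S₀
  have hd : ∀ x : K, O.valuation x < 1 ↔ V.valuation (ι x) < 1 := fun x =>
    (valuation_map_lt_one_iff ι hVO x).symm
  have hexne : ∀ f ∈ S₀, f ≠ 0 → aeval ρ' f ≠ 0 := fun f hf' hf0 h0 => by
    have h' := hex f hf'
    rw [h0, map_zero, eq_comm, Valuation.zero_iff, _root_.map_eq_zero] at h'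
    exact haev0 f hf0 h'
  set D : Subalgebra K₀ K := Algebra.adjoin K₀ (insert v (T : Set K)) with hDdef
  have hTD : ∀ x ∈ T, x ∈ D := fun x hx =>
    Algebra.subset_adjoin (Set.mem_insert_of_mem _ (Finset.mem_coe.mpr hx))
  have hDK₁ : ∀ z : D, (z : K) ∈ K₁ := by
    have hle' : D ≤ K₁.toSubalgebra := Algebra.adjoin_le
      (Set.insert_subset_iff.mpr ⟨hvK₁, fun x hx => hTK₁ x (Finset.mem_coe.mp hx)⟩)
    exact fun z => hle' z.2
  have hK₀D : ∀ x : K₀, (x : K) ∈ D := fun x => D.algebraMap_mem x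
  have hpolyD : ∀ A : K₀[X], aeval v A ∈ D := fun A => Algebra.adjoin_le
    (Set.singleton_subset_iff.mpr (Algebra.subset_adjoin (Set.mem_insert _ _)))
    (aeval_mem_adjoin_singleton K₀ v)
  obtain ⟨φ', hφ'poly, hexT, hφ'L₀⟩ := HenselShadows.exists_exact_evalMap V ι hv ρ' T P Q hQ0
    (fun x hx => hPQ x (hTK₁ x hx)) (fun x hx => hex _ (hPmem x hx))
    (fun x hx => hex _ (hQmem x hx)) (fun x hx => hexne _ (hQmem x hx) (hQ0 x))
  have hK₀M : ∀ x : K₀, algebraMap K₀ M x = ι (x : K) := fun x =>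
    IsScalarTower.algebraMap_apply K₀ K M x
  have hexT' : ∀ z : D, ((z : K) ∈ T ∨ (z : K) = 0) → V.valuation (φ' z) = V.valuation (ι z) := by
    rintro z (hz | hz)
    · exact hexT z hz
    · rw [show z = 0 from Subtype.ext hz]; simp
  /- 5. lifting the polynomials to `D[X]`; the root package -/
  set iD : D →+* K := D.val.toRingHom with hiDdef
  have hiD : Function.Injective iD := Subtype.val_injective
  have hiDapp : ∀ z : D, iD z = (z : K) := fun z => rfl
  set φD : D →+* M := φ'.toRingHom with hφDdef
  have hφDapp : ∀ z : D, φD z = φ' z := fun z => rfl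
  have hliftD : ∀ r ∈ Tpoly, ∃ rD : D[X], rD.map iD = r := fun r hr =>
    (mem_lifts r).mp ((lifts_iff_coeff_lifts r).mpr fun n => by
      by_cases h0 : r.coeff n = 0
      · exact ⟨0, by rw [h0, map_zero]⟩
      · exact ⟨⟨r.coeff n, hTD _ (hTc r hr n h0)⟩, rfl⟩)
  choose! lift hlift using hliftD
  set aD : D := ⟨a, hTD a hT_a⟩ with haDdef
  have hevalD : ∀ rD : D[X], iD (rD.eval aD) = (rD.map iD).eval a := fun rD => by
    show iD (rD.eval aD) = (rD.map iD).eval (iD aD)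
    rw [eval_map, eval₂_hom]
  have hcoefr : ∀ r ∈ Tpoly, ∀ n, iD ((lift r).coeff n) = r.coeff n := fun r hr n => by
    rw [← coeff_map, hlift r hr]
  have hevalr : ∀ r ∈ Tpoly, iD ((lift r).eval aD) = r.eval a := fun r hr => by
    rw [hevalD, hlift r hr]
  have hexcoef : ∀ r ∈ Tpoly, ∀ n, V.valuation (φD ((lift r).coeff n)) =
      V.valuation (ι (iD ((lift r).coeff n))) := by
    intro r hr n
    refine hexT' _ ?_
    rw [← hiDapp, hcoefr r hr n]
    by_cases h0 : r.coeff n = 0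
    exacts [Or.inr h0, Or.inl (hTc r hr n h0)]
  have hexeval : ∀ r ∈ Tpoly, V.valuation (φD ((lift r).eval aD)) =
      V.valuation (ι (iD ((lift r).eval aD))) := fun r hr =>
    hexT _ (by rw [← hiDapp, hevalr r hr]; exact hTe r hr)
  have hdDa : iD ((derivative (lift h)).eval aD) = (derivative h).eval a := by
    rw [hevalD, ← derivative_map, hlift h hhT]
  set c₀D : D := algebraMap K₀ D (algebraMap k K₀ c₀) with hc₀Ddef
  have hc₀DK : (c₀D : K) = c₀K := by
    rw [hc₀Ddef, Subalgebra.coe_algebraMap, ← IsScalarTower.algebraMap_apply]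
  have hφc₀ : φD c₀D = algebraMap k M c₀ := by
    rw [hφDapp, hc₀Ddef, AlgHom.commutes, ← IsScalarTower.algebraMap_apply]
  have hfac : lift h = lift m * lift g := Polynomial.map_injective iD hiD (by
    rw [Polynomial.map_mul, hlift h hhT, hlift m hmT, hlift g hgT, hhmg])
  obtain ⟨ζ, hζV, hζroot, hmφζ, hζc₀, hhφV, hhφder, hζa⟩ :=
    HenselShadows.exists_root_package O V ι hVO iD φD (lift h) (lift m) (lift g) aD c₀D (bnd g)
      hfac (fun n => by rw [hcoefr h hhT n]; exact hcoefO n) (hexcoef h hhT) (hexcoef g hgT)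
      (hexT aD hT_a) haO (hexeval h hhT) (hexT _ (by rw [← hiDapp, hdDa]; exact hT_da))
      (hexeval g hgT) (hexT _ (by rw [Subalgebra.coe_sub, hc₀DK]; exact hT_ac₀))
      (by rw [hdDa]; exact hda) (by rw [hevalr h hhT]; exact hha1)
      (by rw [hiDapp, Subalgebra.coe_sub, hc₀DK]; exact hac₀)
      (fun n => by rw [hcoefr g hgT n]; exact hbnd g n)
      (by rw [hevalr h hhT, hevalr g hgT]; exact (hgap g hgT hgη).1)
      (by
        rw [hevalr g hgT]
        intro h0
        have h1 := (hgap g hgT hgη).2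
        rw [h0, map_zero, eq_comm, Valuation.zero_iff] at h1
        exact hgη h1)
  rw [hevalr h hhT] at hζa
  replace hζc₀ : V.valuation (ζ - algebraMap k M c₀) < 1 := by rw [← hφc₀]; exact hζc₀
  /- 6. `η ↦ ζ` extends `φ'` to `Φ : E = D[η] → M` -/
  have hmDmon : (lift m).Monic := monic_of_injective hiD (by rw [hlift m hmT]; exact hmmon)
  have hmDη : (lift m).eval₂ iD η = 0 := by rw [← eval_map, hlift m hmT]; exact hmη
  have hmDζ : (lift m).eval₂ φD ζ = 0 := by rw [← eval_map]; exact hmφζ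
  have hminD : ∀ r : D[X], r.eval₂ iD η = 0 → r.degree < (lift m).degree → r = 0 := by
    intro r hr hdeg
    have h1 : r.map iD = 0 := hmin (r.map iD) (fun i => by rw [coeff_map]; exact hDK₁ _)
      (by rwa [eval_map])
      (by rwa [degree_map_eq_of_injective hiD, ← hlift m hmT, degree_map_eq_of_injective hiD])
    exact (Polynomial.map_eq_zero_iff hiD).mp h1
  set E : Subring K := @RingHom.range D[X] K _ _ (eval₂RingHom iD η) with hEdef
  obtain ⟨Φ, hΦ⟩ :=
    HenselShadows.exists_ringHom_of_root iD φD η ζ (lift m) hmDmon hmDη hmDζ hminD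
  have hΦ' : ∀ (P₁ : D[X]) (e : E), (e : K) = P₁.eval₂ iD η → Φ e = (P₁.map φD).eval ζ := by
    intro P₁ e he'
    rw [show e = ⟨P₁.eval₂ iD η, P₁, rfl⟩ from Subtype.ext he', hΦ, eval_map]
  have hDE : ∀ d : D, (d : K) ∈ E := fun d => ⟨C d, by rw [coe_eval₂RingHom, eval₂_C]; rfl⟩
  have hΦD : ∀ (d : D) (e : E), (e : K) = (d : K) → Φ e = φD d := fun d e he' => by
    rw [hΦ' (C d) e (by rw [he', eval₂_C]; rfl), map_C, eval_C]
  have hηE : η ∈ E := ⟨X, by rw [coe_eval₂RingHom, eval₂_X]⟩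
  have hΦη : ∀ e : E, (e : K) = η → Φ e = ζ := fun e he' => by
    rw [hΦ' X e (by rw [he', eval₂_X]), Polynomial.map_X, eval_X]
  have hkE : ∀ c : k, algebraMap k K c ∈ E := fun c => by
    rw [IsScalarTower.algebraMap_apply k K₀ K]; exact hDE ⟨_, hK₀D _⟩
  have hΦk : ∀ (c : k) (e : E), (e : K) = algebraMap k K c → Φ e = algebraMap k M c := by
    intro c e he'
    rw [hΦD (algebraMap K₀ D (algebraMap k K₀ c)) e
      (by rw [he', Subalgebra.coe_algebraMap, ← IsScalarTower.algebraMap_apply]), hφDapp,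
      AlgHom.commutes, ← IsScalarTower.algebraMap_apply]
  have hZsE : ∀ z ∈ Z ∪ s, z ∈ E := fun z hz =>
    ⟨lift (rep z), by rw [coe_eval₂RingHom, ← eval_map, hlift _ (hrepT z hz), hrepη]⟩
  /- 7. the transport on the prescribed elements -/
  have hνZ : ∀ z ∈ Z, z ≠ 0 → O.valuation ((rep z).eval a) = O.valuation z := fun z hz hz0 => by
    have h1 := (hgap (rep z) (hrepT z (Finset.mem_union_left _ hz)) (by rw [hrepη]; exact hz0)).2
    rwa [hrepη] at h1
  have hΦZ : ∀ z ∈ Z, z ≠ 0 → ∀ e : E, (e : K) = z →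
      V.valuation (Φ e) = V.valuation (ι ((rep z).eval a)) := by
    intro z hz hz0 e he'
    have hr := hrepT z (Finset.mem_union_left _ hz)
    have hg' := (hgap (rep z) hr (by rw [hrepη]; exact hz0)).1
    rw [hΦ' (lift (rep z)) e (by rw [he', ← eval_map, hlift _ hr, hrepη])]
    have h1 := HenselShadows.transport O V ι hVO iD φD (lift (rep z)) aD (bnd (rep z)) (h.eval a)
      ζ (hexcoef _ hr) (hexT aD hT_a) haO (hexeval _ hr)
      (fun n => by rw [hcoefr _ hr]; exact hbnd _ n) hζV hζa (by rw [hevalr _ hr]; exact hg')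
    rwa [hevalr _ hr] at h1
  /- 8. the frame polynomial and the field `L = K₀(ρ', ζ)` -/
  set Lf : IntermediateField K₀ M := IntermediateField.adjoin K₀ {ρ', ζ} with hLfdef
  have hL₀Lf : IntermediateField.adjoin K₀ {ρ'} ≤ Lf :=
    IntermediateField.adjoin.mono K₀ _ _ (Set.singleton_subset_iff.mpr (Set.mem_insert _ _))
  have hζLf : ζ ∈ Lf := IntermediateField.subset_adjoin K₀ _ (Set.mem_insert_of_mem _ rfl)
  have hhφmon : ((lift h).map φD).Monic :=
    (monic_of_injective hiD (by rw [hlift h hhT]; exact hmon)).map φD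
  obtain ⟨gπ, hgπ0, hgπdeg, hπ1, hLval⟩ := HenselShadows.exists_frame_poly k K M O hk V hVO K₀ t
    htK₀ ht0 ht1 hdisc harchV hρ'int hhφV (fun n => by rw [coeff_map]; exact hφ'L₀ _) hhφmon hζV
    hζroot hhφder hζc₀
  set π : M := aeval ρ' gπ with hπdef
  set eK : K := aeval v gπ with heKdef
  have hπex : V.valuation π = V.valuation (ι eK) := hexlow gπ hgπ0 hgπdeg
  have heK0 : eK ≠ 0 := haev0 gπ hgπ0
  have heK1 : O.valuation eK < 1 := (hd eK).mpr (by rw [← hπex]; exact hπ1)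
  have heKO : eK ∈ O := (O.valuation_le_one_iff _).mp heK1.le
  have heKD : eK ∈ D := hpolyD gπ
  have hφ'eK : φ' ⟨eK, heKD⟩ = π := hφ'poly gπ heKD
  have hΦLf : ∀ e : E, Φ e ∈ Lf := by
    rintro ⟨e, P₁, rfl⟩
    rw [hΦ' P₁ ⟨_, P₁, rfl⟩ rfl]
    exact eval_mem_subfield_of_coeff_mem (L := Lf.toSubfield)
      (fun n => by rw [coeff_map]; exact hL₀Lf (hφ'L₀ _)) hζLf
  /- 9. the assembly -/
  have htD : t ∈ D := hK₀D ⟨t, htK₀⟩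
  have htDeq : (⟨t, htD⟩ : D) = algebraMap K₀ D ⟨t, htK₀⟩ := Subtype.ext rfl
  refine HenselShadows.shadow_of_transport k K M O hk hrat hrr V hVO hres K₀ Lf R R₀ hRR₀ hR₀O
    hfrac₀ s hs cst (fun x hx => hcst x (hsO x hx)) E hkE Φ hΦk hΦLf {t, η, eK} ?_ ?_ ?_
    (fun x hx => hZsE x (Finset.mem_union_right _ hx)) F ?_ ?_ eK (by simp) heK0 heK1 π
    (fun e he' => by rw [hΦD ⟨eK, heKD⟩ e he', hφDapp, hφ'eK]) hπex hLval
  · simp only [Finset.mem_insert, Finset.mem_singleton, forall_eq_or_imp, forall_eq]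
    exact ⟨hDE ⟨t, htD⟩, hηE, hDE ⟨eK, heKD⟩⟩
  · simp only [Finset.mem_insert, Finset.mem_singleton, forall_eq_or_imp, forall_eq]
    exact ⟨(O.valuation_le_one_iff _).mp ht1.le, hηO, heKO⟩
  · simp only [Finset.mem_insert, Finset.mem_singleton, forall_eq_or_imp, forall_eq]
    refine ⟨⟨0, by rw [map_zero, sub_zero]; exact ht1, fun e he' => ?_⟩,
      ⟨c₀, hc₀, fun e he' => by rw [hΦη e he']; exact hζc₀⟩,
      ⟨0, by rw [map_zero, sub_zero]; exact heK1, fun e he' => ?_⟩⟩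
    · rw [map_zero, sub_zero, hΦD ⟨t, htD⟩ e he', hφDapp, htDeq, AlgHom.commutes, hK₀M]
      exact (hd t).mp ht1
    · rw [map_zero, sub_zero, hΦD ⟨eK, heKD⟩ e he', hφDapp, hφ'eK]
      exact hπ1
  · intro x hxs hz0
    have hzZ : x - algebraMap k K (cst x) ∈ Z :=
      Finset.mem_union_left _ (Finset.mem_image.mpr ⟨x, hxs, rfl⟩)
    exact ⟨_, hνZ _ hzZ hz0, hΦZ _ hzZ hz0⟩
  · intro x hxF hx0
    have hzZ : ((x : R) : K) ∈ Z := Finset.mem_union_right _ (Finset.mem_image.mpr ⟨x, hxF, rfl⟩)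
    exact ⟨_, hνZ _ hzZ hx0, hΦZ _ hzZ hx0⟩

end Summit.ResolutionOfSingularities.ResolutionOfSingularities.Theorems

end
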